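import Summits.HodgeConjecture.CorCM.GaloisCertificateSplitTwo
import Summits.HodgeConjecture.CorCM.GaloisDegenerateSplitExtension
import HarnessLib

/-!
# A real quadratic factor never rescues a BAD field: `K ⊇ K₀` Galois CM, `[K : K₀] = 2`, restriction split through complex
# conjugation, `Gal(K₀/ℚ)` not of exponent two, `K₀` BAD ⟹ `K` BAD

COR-CM (cell `pub-hodgecm2`), binder seat b04 (gen 31), count-neutral own lane «Galois-CM-type classification»; the FIELD FORM
of `CorCM/GaloisCertificateSplitTwo` (as `CorCM/GaloisDegenerateSplitExtension` is the field form of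
`CorCM/GaloisCertificateSplitExtension`).  KERNEL ONLY: theorems; no definition, no named fact, no `sorry`.  `HC_CM` is neither
used nor claimed.

* `eq_one_or_eq_of_restrictNormalHom_eq_one` — `[K : K₀] = 2`: the kernel of `Gal(K/ℚ) → Gal(K₀/ℚ)` is `{1, τ}`.
* **`exists_simple_degenerate_of_subfield_split_two`**: `K ⊇ K₀ ⊇ ℚ` Galois CM fields with `[K : K₀] = 2`; `σ` a homomorphic
  section of the restriction whose image contains complex conjugation (e.g. `K = K₀(√d)`, `d ∈ ℚ_{>0}`, `√d ∉ K₀`: `σ` = inverse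
  of restriction on `Gal(K/ℚ(√d))`); `Gal(K₀/ℚ)` NOT of exponent `2`; `K₀` has a PRIMITIVE DEGENERATE CM type (read as an integer
  certificate by `exists_certificate_of_not_isNondegenerate`) ⟹ `K` carries a SIMPLE DEGENERATE abelian variety of dimension
  `[K:ℚ]/2` with CM by `K` (a rational `(p,p)` class outside the divisor ring on some power).
* **`exists_simple_degenerate_of_subfield_complement_two`** — the same with the section given as a subgroup `Γ ≤ Gal(K/ℚ)`
  through complex conjugation, meeting `Gal(K/K₀)` trivially, `|Γ| = [K₀:ℚ]`.
Together with `CorCM/GaloisDegenerateSplitExtension` (`[K:K₀] ≥ 3`): **along split CM extensions `K ⊇ K₀` with complex conjugation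
in the complement, BAD(K₀) ⟹ BAD(K)** — equivalently GOOD(K) ⟹ GOOD(K₀) — with the single possible exception `[K:K₀] = 2`,
`Gal(K₀/ℚ) ≅ C₂ᵏ` (settled anyway by the abelian classification).  In the classification: the rows `D_{2^k}(2^{k+1}) × C₂`,
`SD_{2^{k+1}} × C₂`, `M_{2^{k+1}} × C₂` (`k ≥ 4`) are BAD.

## References

* [Kubota1965] T. Kubota, *On the field extension by complex multiplication*, Trans. AMS 118 (1965), §2, §4 Lemma 2.
* [Shimura1998] G. Shimura, *Abelian Varieties with Complex Multiplication and Modular Functions*, §6.2 Thm. 3, §8.2 Prop. 26.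
* [Gordon1999HodgeAVSurvey] B. B. Gordon, *A survey of the Hodge conjecture for abelian varieties*, Thm. 6.4, §9.3.
-/

noncomputable section

open CategoryTheory CategoryTheory.Limits NumberField
open scoped BigOperators

namespace Summit.HodgeConjecture.CorCM.GaloisModels

open Literature.NumberTheory.ComplexMultiplication
open Literature.AlgebraicGeometry.Motives (AbelianVariety CMType)
open Literature.AlgebraicGeometry.HodgeTheory
open Literature.AlgebraicGeometry.ComplexMultiplication (IsCMTypeRealisation)
open Literature.AlgebraicGeometry.Pohlmann1968
open Literature.Barriers.HodgeConjecture (divisorClassesSpan)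
open Summit.HodgeConjecture.CorCM.GaloisRank

section Field

variable {K : Type} [Field K] [NumberField K] [IsCMField K] [IsGalois ℚ K]
variable (K₀ : Type) [Field K₀] [NumberField K₀] [IsCMField K₀] [IsGalois ℚ K₀] [Algebra K₀ K] [IsScalarTower ℚ K₀ K]

omit [IsCMField K] [IsCMField K₀] in
/-- `[K : K₀] = 2`: an automorphism restricting trivially to `K₀` is `1` or the non-trivial `K₀`-automorphism. [folklore] -/
theorem eq_one_or_eq_of_restrictNormalHom_eq_one (hdeg : Module.finrank K₀ K = 2) :
    ∃ τ : K ≃ₐ[K₀] K, τ ≠ 1 ∧ ∀ g : K ≃ₐ[ℚ] K, AlgEquiv.restrictNormalHom K₀ g = 1 →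
      g = 1 ∨ g = τ.restrictScalars ℚ := by
  haveI : IsGalois K₀ K := IsGalois.tower_top_of_isGalois ℚ K₀ K
  have hcard : Nat.card (K ≃ₐ[K₀] K) = 2 := by rw [IsGalois.card_aut_eq_finrank, hdeg]
  obtain ⟨τ, hτ, hτu⟩ := SplitExtension.exists_ne_one_of_card_eq_two hcard
  refine ⟨τ, hτ, fun g hg => ?_⟩
  -- `g` is `K₀`-linear
  let g' : K ≃ₐ[K₀] K :=
    { g.toRingEquiv with commutes' := fun x => apply_algebraMap_of_restrictNormalHom_eq_one K₀ hg x }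
  have hg' : g'.restrictScalars ℚ = g := AlgEquiv.ext fun x => rfl
  rcases hτu g' with h | h
  · left
    rw [← hg', h]
    exact AlgEquiv.ext fun x => rfl
  · right
    rw [← hg', h]

/-- **A REAL QUADRATIC FACTOR NEVER RESCUES A BAD FIELD (field form).**  `K ⊇ K₀ ⊇ ℚ` Galois CM with `[K : K₀] = 2`; `σ` a
homomorphic section of the restriction `Gal(K/ℚ) → Gal(K₀/ℚ)` whose image contains complex conjugation (e.g. `K = K₀(√d)`,
`d ∈ ℚ_{>0}`); `Gal(K₀/ℚ)` not of exponent `2`; and `K₀` has a PRIMITIVE DEGENERATE CM type ⟹ `K` carries a SIMPLE DEGENERATE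
abelian variety of dimension `[K:ℚ]/2` with CM by `K` (a rational `(p,p)` class outside the divisor ring on some power).
[cite: Kubota1965, §2 and §4 Lemma 2] [cite: Shimura1998, §6.2 Thm. 3 and §8.2 Prop. 26] [cite: Gordon1999HodgeAVSurvey, Thm. 6.4 and §9.3] -/
theorem exists_simple_degenerate_of_subfield_split_two (σ : (K₀ ≃ₐ[ℚ] K₀) →* (K ≃ₐ[ℚ] K))
    (hσ : ∀ q, AlgEquiv.restrictNormalHom K₀ (σ q) = q)
    (hc : ∃ q, σ q = (IsCMField.complexConj K).restrictScalars ℚ) (hdeg : Module.finrank K₀ K = 2)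
    (hexp : ∃ g : K₀ ≃ₐ[ℚ] K₀, g * g ≠ 1)
    (Φ₀ : CMType K₀) (φ₀ : K₀ →+* ℂ) (hprim : IsPrimitive (ℂ ≃+* ℂ) Φ₀.1 φ₀) (hndg : ¬ IsNondegenerate Φ₀) :
    ∃ (Φ : CMType K) (φ : K →+* ℂ) (X : AbelianVariety ℂ) (ι : 𝓞 K →+* End X)
      (ϑ : K →+* Module.End ℂ (complexBetti X.X 1)),
      IsPrimitive (ℂ ≃+* ℂ) Φ.1 φ ∧ ¬ IsNondegenerate Φ ∧ IsCMTypeRealisation Φ X ι ϑ ∧ X.IsSimple ∧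
      X.dim = Module.finrank ℚ K / 2 ∧
      ∃ m p : ℕ, ∃ y : complexBetti (⨁ fun _ : Fin m => X).X (2 * p), IsRationalClass y ∧
        IsOfHodgeType (⨁ fun _ : Fin m => X).dim (⨁ fun _ : Fin m => X).X (2 * p) p p y ∧
        y ∉ divisorClassesSpan (⨁ fun _ : Fin m => X).X (⨁ fun _ : Fin m => X).dim p := by
  classical
  have hc' : (MulEquiv.refl (K ≃ₐ[ℚ] K)) ((IsCMField.complexConj K).restrictScalars ℚ) =
      σ ((IsCMField.complexConj K₀).restrictScalars ℚ) := by
    obtain ⟨q, hq⟩ := hc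
    have hq' : q = (IsCMField.complexConj K₀).restrictScalars ℚ := by
      rw [← hσ q, hq, restrictNormalHom_complexConj_of_tower K₀]
    rw [MulEquiv.refl_apply, ← hq, hq']
  obtain ⟨τ, hτ, hker⟩ := eq_one_or_eq_of_restrictNormalHom_eq_one K₀ hdeg
  have hone : ((1 : K ≃ₐ[K₀] K).restrictScalars ℚ : K ≃ₐ[ℚ] K) = 1 := AlgEquiv.ext fun x => rfl
  have h₁ : (τ.restrictScalars ℚ : K ≃ₐ[ℚ] K) ≠ 1 := fun h =>
    hτ (AlgEquiv.restrictScalars_injective ℚ (h.trans hone.symm))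
  obtain ⟨T₀, b, -, hcm, hprim', hanti, hann, hb⟩ :=
    exists_certificate_of_not_isNondegenerate (MulEquiv.refl (K₀ ≃ₐ[ℚ] K₀))
      (c₀ := (IsCMField.complexConj K₀).restrictScalars ℚ) rfl Φ₀ φ₀ hprim hndg
  obtain ⟨Φ, φ, X, ι, ϑ, H1, H2, H3, H4, H5, H6⟩ :=
    exists_simple_degenerate_of_split_two_certificate (MulEquiv.refl (K ≃ₐ[ℚ] K)) (AlgEquiv.restrictNormalHom K₀) σ hσ
      (n₁ := τ.restrictScalars ℚ) (restrictNormalHom_restrictScalars_eq_one K₀ τ) h₁ hker hexp _ hc' T₀ hcm hprim' b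
      hanti hann hb
  refine ⟨Φ, φ, X, ι, ϑ, H1, H2, H3, H4, ?_, H6⟩
  rw [H5, card_model_eq_finrank (MulEquiv.refl (K ≃ₐ[ℚ] K))]

/-- **… with the section given as a SUBGROUP** `Γ ≤ Gal(K/ℚ)` containing complex conjugation, meeting `Gal(K/K₀)` trivially,
`|Γ| = [K₀:ℚ]`, `[K : K₀] = 2`, `Gal(K₀/ℚ)` not of exponent `2`, `K₀` with a primitive degenerate CM type ⟹ `K` carries a
simple degenerate abelian variety of dimension `[K:ℚ]/2` with CM by `K`. [cite: Kubota1965, §2 and §4 Lemma 2]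
[cite: Shimura1998, §6.2 Thm. 3 and §8.2 Prop. 26] [cite: Gordon1999HodgeAVSurvey, Thm. 6.4 and §9.3] -/
theorem exists_simple_degenerate_of_subfield_complement_two (Γ : Subgroup (K ≃ₐ[ℚ] K))
    (hcΓ : (IsCMField.complexConj K).restrictScalars ℚ ∈ Γ)
    (hdisj : ∀ g ∈ Γ, AlgEquiv.restrictNormalHom K₀ g = 1 → g = 1) (hcard : Nat.card Γ = Module.finrank ℚ K₀)
    (hdeg : Module.finrank K₀ K = 2) (hexp : ∃ g : K₀ ≃ₐ[ℚ] K₀, g * g ≠ 1) (Φ₀ : CMType K₀) (φ₀ : K₀ →+* ℂ)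
    (hprim : IsPrimitive (ℂ ≃+* ℂ) Φ₀.1 φ₀) (hndg : ¬ IsNondegenerate Φ₀) :
    ∃ (Φ : CMType K) (φ : K →+* ℂ) (X : AbelianVariety ℂ) (ι : 𝓞 K →+* End X)
      (ϑ : K →+* Module.End ℂ (complexBetti X.X 1)),
      IsPrimitive (ℂ ≃+* ℂ) Φ.1 φ ∧ ¬ IsNondegenerate Φ ∧ IsCMTypeRealisation Φ X ι ϑ ∧ X.IsSimple ∧
      X.dim = Module.finrank ℚ K / 2 ∧
      ∃ m p : ℕ, ∃ y : complexBetti (⨁ fun _ : Fin m => X).X (2 * p), IsRationalClass y ∧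
        IsOfHodgeType (⨁ fun _ : Fin m => X).dim (⨁ fun _ : Fin m => X).X (2 * p) p p y ∧
        y ∉ divisorClassesSpan (⨁ fun _ : Fin m => X).X (⨁ fun _ : Fin m => X).dim p := by
  set ρ : Γ →* (K₀ ≃ₐ[ℚ] K₀) := (AlgEquiv.restrictNormalHom K₀).restrict Γ with hρ_def
  have hρinj : Function.Injective ρ := by
    intro x y h
    apply Subtype.ext
    have h' : AlgEquiv.restrictNormalHom K₀ ((x : K ≃ₐ[ℚ] K) * (y : K ≃ₐ[ℚ] K)⁻¹) = 1 := by
      rw [map_mul, map_inv, mul_inv_eq_one]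
      exact h
    exact mul_inv_eq_one.1 (hdisj _ (Γ.mul_mem x.2 (Γ.inv_mem y.2)) h')
  have hρbij : Function.Bijective ρ := hρinj.bijective_of_nat_card_le (by rw [IsGalois.card_aut_eq_finrank, hcard])
  set ε : Γ ≃* (K₀ ≃ₐ[ℚ] K₀) := MulEquiv.ofBijective ρ hρbij with hε_def
  have hε : ∀ x : Γ, ε x = AlgEquiv.restrictNormalHom K₀ (x : K ≃ₐ[ℚ] K) := fun x => rfl
  refine exists_simple_degenerate_of_subfield_split_two K₀ (Γ.subtype.comp ε.symm.toMonoidHom) (fun q => ?_)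
    ⟨ε ⟨_, hcΓ⟩, ?_⟩ hdeg hexp Φ₀ φ₀ hprim hndg
  · rw [MonoidHom.comp_apply, MulEquiv.coe_toMonoidHom, Subgroup.coe_subtype, ← hε, MulEquiv.apply_symm_apply]
  · rw [MonoidHom.comp_apply, MulEquiv.coe_toMonoidHom, MulEquiv.symm_apply_apply, Subgroup.coe_subtype]

end Field

end Summit.HodgeConjecture.CorCM.GaloisModels

end
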